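import Summits.BirchSwinnertonDyer.BirchSwinnertonDyer.Theorems.ThetaPartnerAtTwoSignedKatoUpToAtTwoHondaLogCharSumsEll
import HarnessLib

/-!
# Route `ThetaPartnerAtTwo` (TP2), crux K3 `SignedKatoDivisibilityUpToAtTwo` (item stmt-BirchSwinnertonDyer-20308), line `colemanrat` —
# (R3) part 5: the TRIVIAL CHARACTER — the trace `∑_a σ_a(ℓ_N)` of Kobayashi's logarithm value (Ramanujan sums at prime powers)

Width seat `bsd-wall-tp2-p2x-w2` g5 (cell `bsd-wall`). HONEST FRAMING: theorems only (no definition, no named fact, no instance,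
no `sorry`); generic cyclotomic algebra in a field `R` with a primitive `p^N`-th root of unity; nothing about any curve; closes no item;
K3 is NOT settled and BSD is NOT proved by any of this.

## What is here (same namespace as `…HondaLogCharSums(Ell)`)

The character-value socket CORE_χ (w3 g6) quantifies over ALL even characters of `ℤ/2^{n+2}`, so the (R3) input «character sums of the
logarithms of the plus Honda points» is needed for primitive characters (lead g6, `…HondaLogCharSum`, `HondaLog.sum_mul_ptLogΩ_act_plusPoint_eq`),
for imprimitive non-trivial ones (`HondaLogChi.sum_changeLevel_mul_ellConj(_eq_zero)`, parts 1–2) and for the TRIVIAL character, i.e. the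
TRACE `∑_{a ∈ (ℤ/p^N)ˣ} σ_a(ℓ_N)` — this file. With `σ_a(ℓ_N) = ∑_{k<N} (−1)^k ((ζ^{p^{2k}})^a − 1)/p^k` (`ζ` primitive of order `p^N`):

* `sum_one_mul_pow_eq_zero_of_lt` — `∑_a 𝟙(a)·(ζ^{p^j})^a = 0` for `j + 2 ≤ N` (the unit sum of a root of unity of order `p^{N−j} ≥ p²`);
* `sum_one_mul_pow_eq_neg_of_eq` — `= −p^{N−1}` for `j + 1 = N` (order exactly `p`: Ramanujan);
* `sum_one_mul_pow_eq_card_of_le` — `= φ(p^N)` for `N ≤ j` (`ζ^{p^j} = 1`);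
* `sum_one_mul_ellConj` — the assembled trace:
  `∑_a 𝟙(a) σ_a(ℓ_N) = ∑_{k<N} (−1)^k p^{−k}·(c_k − φ(p^N))` with `c_k = 0` (`2k + 2 ≤ N`), `−p^{N−1}` (`2k + 1 = N`), `φ(p^N)` (`N ≤ 2k`) —
  stated as the expansion `sum_mul_ellConj_expand` with each single sum evaluated by the three lemmas (the consumer picks the closed
  form it needs).

References: [Kobayashi2003] §8.4, Prop. 8.26 and the proof of Thm. 6.3 (trivial character / constant terms) (pp. 24–25); [Washington1997] Lemma 4.8.
-/

set_option autoImplicit false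
-- the Theorems namespace of this sub repeats the summit name by design (D-0017 nested layout)
set_option linter.dupNamespace false

noncomputable section

open scoped Classical

open DirichletCharacter AddChar Finset

namespace Summit.BirchSwinnertonDyer.BirchSwinnertonDyer.Theorems.SignedKatoOffTwo.HondaLogChi

variable {R : Type*} [Field R] {p : ℕ} [hp : Fact p.Prime]

/-- **Trivial character, root of order `≥ p²`**: for `j + 2 ≤ N` and `ζ` primitive of order `p^N`, `∑_a 𝟙(a)(ζ^{p^j})^a = 0`
(level raising to `p^{N−j}`, where the unit sum of a root of unity of order `p^{N−j} ≥ p²` vanishes). [cite: Washington1997, Lemma 4.8] -/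
theorem sum_one_mul_pow_eq_zero_of_lt {N j : ℕ} (hj : j + 2 ≤ N) {ζ : R} (hζ : IsPrimitiveRoot ζ (p ^ N)) :
    ∑ a : ZMod (p ^ N), (1 : DirichletCharacter R (p ^ N)) a * (ζ ^ p ^ j) ^ a.val = 0 := by
  have hζN : ζ ^ p ^ N = 1 := hζ.pow_eq_one
  have hjN : j ≤ N := by omega
  have hM : 1 ≤ N - j := by omega
  have hMN : N - j ≤ N := Nat.sub_le N j
  have hζ' : (ζ ^ p ^ j) ^ p ^ (N - j) = 1 := by
    rw [← pow_mul, ← pow_add, Nat.add_sub_cancel' hjN, hζN]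
  have hζ'p : (ζ ^ p ^ j) ^ p ≠ 1 := by
    rw [← pow_mul, ← pow_succ]
    exact hζ.pow_ne_one_of_pos_of_lt (pow_ne_zero _ hp.out.ne_zero) (Nat.pow_lt_pow_right hp.out.one_lt (by omega))
  have h := gaussSum_changeLevel_zmodChar hM hMN (1 : DirichletCharacter R (p ^ (N - j))) (pow_pow_pow_eq_one hζN j) hζ'
  rw [changeLevel_one, gaussSum_one_zmodChar_eq_zero hM hζ' hζ'p, mul_zero] at h
  simpa only [gaussSum, zmodChar_apply] using h

/-- **Trivial character, root of order exactly `p`**: for `j + 1 = N`, `∑_a 𝟙(a)(ζ^{p^j})^a = −p^{N−1}` (Ramanujan sum: level raising to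
`p`, where `∑_{a unit mod p} ξ^a = −1` for the primitive `p`-th root `ξ = ζ^{p^{N−1}}`). [cite: Washington1997, Lemma 4.8] -/
theorem sum_one_mul_pow_eq_neg_of_eq {N j : ℕ} (hj : j + 1 = N) {ζ : R} (hζ : IsPrimitiveRoot ζ (p ^ N)) :
    ∑ a : ZMod (p ^ N), (1 : DirichletCharacter R (p ^ N)) a * (ζ ^ p ^ j) ^ a.val = -((p : R) ^ (N - 1)) := by
  have hζN : ζ ^ p ^ N = 1 := hζ.pow_eq_one
  have hprim : IsPrimitiveRoot (ζ ^ p ^ j) p := by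
    exact hζ.pow (pow_pos hp.out.pos N) (show p ^ N = p ^ j * p by rw [← pow_succ, hj])
  have hζ1 : (ζ ^ p ^ j) ^ p ^ 1 = 1 := by rw [pow_one]; exact hprim.pow_eq_one
  have h := gaussSum_changeLevel_zmodChar le_rfl (by omega : 1 ≤ N) (1 : DirichletCharacter R (p ^ 1))
    (pow_pow_pow_eq_one hζN j) hζ1
  rw [changeLevel_one, gaussSum_one_zmodChar_prime hprim hζ1, mul_neg, mul_one] at h
  rw [show ∑ a : ZMod (p ^ N), (1 : DirichletCharacter R (p ^ N)) a * (ζ ^ p ^ j) ^ a.val =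
      gaussSum (1 : DirichletCharacter R (p ^ N)) (zmodChar (p ^ N) (pow_pow_pow_eq_one hζN j)) by
    simp only [gaussSum, zmodChar_apply], h, Nat.cast_pow]

/-- **Trivial character, trivial root**: for `N ≤ j`, `ζ^{p^j} = 1` and `∑_a 𝟙(a)(ζ^{p^j})^a = φ(p^N) = #(ℤ/p^N)ˣ`. [folklore] -/
theorem sum_one_mul_pow_eq_card_of_le {N j : ℕ} (hj : N ≤ j) {ζ : R} (hζN : ζ ^ p ^ N = 1) :
    ∑ a : ZMod (p ^ N), (1 : DirichletCharacter R (p ^ N)) a * (ζ ^ p ^ j) ^ a.val = (Nat.totient (p ^ N) : R) := by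
  have h1 : ζ ^ p ^ j = 1 := by
    obtain ⟨d, rfl⟩ := Nat.exists_eq_add_of_le hj
    rw [pow_add, pow_mul, hζN, one_pow]
  simp only [h1, one_pow, mul_one]
  rw [MulChar.sum_one_eq_card_units, ZMod.card_units_eq_totient]

/-- **The trace of `ℓ_N` (trivial character of Kobayashi Prop. 8.26 / the constant terms in the proof of Thm. 6.3)**, as the expansion
`∑_a 𝟙(a) σ_a(ℓ_N) = ∑_{k<N} (−1)^k p^{−k} (∑_a 𝟙(a)(ζ^{p^{2k}})^a − φ(p^N))` whose single sums are `0` (`2k + 2 ≤ N`), `−p^{N−1}` (`2k + 1 = N`)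
or `φ(p^N)` (`N ≤ 2k`) by the three lemmas above. [cite: Kobayashi2003, Prop. 8.26 and proof of Thm. 6.3 (pp. 24–25)] -/
theorem sum_one_mul_ellConj {N : ℕ} (ζ : R) :
    ∑ a : ZMod (p ^ N), (1 : DirichletCharacter R (p ^ N)) a *
        ∑ k ∈ range N, (-1) ^ k * ((ζ ^ p ^ (2 * k)) ^ a.val - 1) / (p : R) ^ k =
      ∑ k ∈ range N, (-1) ^ k / (p : R) ^ k *
        (∑ a : ZMod (p ^ N), (1 : DirichletCharacter R (p ^ N)) a * (ζ ^ p ^ (2 * k)) ^ a.val - (Nat.totient (p ^ N) : R)) := by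
  rw [sum_mul_ellConj_expand, MulChar.sum_one_eq_card_units, ZMod.card_units_eq_totient]

/-- The trace at `p = 2` in closed form for EVEN `N = 2m + 2 ≥ 2`: every single sum with `2k + 2 ≤ N` vanishes and the `k` with `N ≤ 2k`
(`m + 1 ≤ k ≤ N − 1`) contribute `φ(2^N) − φ(2^N) = 0`, so `∑_a 𝟙(a) σ_a(ℓ_N) = −φ(2^N)·∑_{k ≤ m} (−1)^k 2^{−k}`. Stated for general `p`:
`∑_a 𝟙(a) σ_a(ℓ_N) = −φ(p^N) · ∑_{k<m+1} (−1)^k p^{−k}` when `N = 2m + 2`. [cite: Kobayashi2003, proof of Thm. 6.3 (p. 25)] -/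
theorem sum_one_mul_ellConj_even {m : ℕ} {ζ : R} (hζ : IsPrimitiveRoot ζ (p ^ (2 * m + 2))) :
    ∑ a : ZMod (p ^ (2 * m + 2)), (1 : DirichletCharacter R (p ^ (2 * m + 2))) a *
        ∑ k ∈ range (2 * m + 2), (-1) ^ k * ((ζ ^ p ^ (2 * k)) ^ a.val - 1) / (p : R) ^ k =
      -(Nat.totient (p ^ (2 * m + 2)) : R) * ∑ k ∈ range (m + 1), (-1) ^ k / (p : R) ^ k := by
  rw [sum_one_mul_ellConj]
  have hζN : ζ ^ p ^ (2 * m + 2) = 1 := hζ.pow_eq_one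
  -- split `range (2m+2)` at `m + 1`
  rw [← Finset.sum_range_add_sum_Ico _ (by omega : m + 1 ≤ 2 * m + 2), Finset.mul_sum]
  have hlow : ∀ k ∈ range (m + 1), (-1) ^ k / (p : R) ^ k *
      (∑ a : ZMod (p ^ (2 * m + 2)), (1 : DirichletCharacter R (p ^ (2 * m + 2))) a * (ζ ^ p ^ (2 * k)) ^ a.val -
        (Nat.totient (p ^ (2 * m + 2)) : R)) = -(Nat.totient (p ^ (2 * m + 2)) : R) * ((-1) ^ k / (p : R) ^ k) := by
    intro k hk
    rw [Finset.mem_range] at hk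
    rw [sum_one_mul_pow_eq_zero_of_lt (by omega : 2 * k + 2 ≤ 2 * m + 2) hζ, zero_sub]
    ring
  have hhigh : ∀ k ∈ Finset.Ico (m + 1) (2 * m + 2), (-1) ^ k / (p : R) ^ k *
      (∑ a : ZMod (p ^ (2 * m + 2)), (1 : DirichletCharacter R (p ^ (2 * m + 2))) a * (ζ ^ p ^ (2 * k)) ^ a.val -
        (Nat.totient (p ^ (2 * m + 2)) : R)) = 0 := by
    intro k hk
    rw [Finset.mem_Ico] at hk
    rw [sum_one_mul_pow_eq_card_of_le (by omega : 2 * m + 2 ≤ 2 * k) hζN, sub_self, mul_zero]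
  rw [Finset.sum_congr rfl hlow, Finset.sum_congr rfl hhigh, Finset.sum_const_zero, add_zero]

end Summit.BirchSwinnertonDyer.BirchSwinnertonDyer.Theorems.SignedKatoOffTwo.HondaLogChi

end
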